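import Summits.CriticalPhenomena.CardyFormulaZ2.Theorems.CardySelfDualSegmentUniformMarginalityDefs
import Summits.CriticalPhenomena.CardyFormulaZ2.Theorems.CardyIKTransportCornerLineDescentFreezeContinuity

/-!
# The crude event of a close rectangle is below the fattened event of the centre (sub-stub N2 of
`stub_fixedDomainContinuity_one`, line `Sketch`, crux `UniformMarginality`, stmt-CriticalPhenomena-5472)

If `Q.carrier ⊆ (R.carrier)_{+η}`, `Q.arc 0 ⊆ (R.arc 0)_{+η}`, `Q.arc 2 ⊆ (R.arc 2)_{+η}` and `2δ + η ≤ ρ`, then the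
crude crossing event of `Q` at mesh `δ` (`crossEvent Q δ`: open lattice path with vertices in `Q.carrier` from within
`2δ` of `Q.arc 0` to within `2δ` of `Q.arc 2`) is contained in the `ρ`-fattened event `Freeze.upperCrossing R ρ δ` of
the centre `R` (vertices within `ρ` of `R.carrier`, endpoints within `ρ` of `R.arc 0` / `R.arc 2`): monotonicity of
`openConnIn` in the window and of the targets (`Freeze.openConnIn_mono`), plus
`infDist p B ≤ infDist p A + η` whenever `A ⊆ cthickening η B`.
-/

noncomputable section

namespace Summit.CriticalPhenomena.CardyFormulaZ2.Cruxes.UniformMarginality.HeatFlow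

open Set Metric
open Literature.Probability.Percolation Literature.Probability.LatticeModels
  Literature.Probability.RandomPlanarGeometry
open Summit.CriticalPhenomena.CardyFormulaZ2.Theorems.CornerLineDescent.SymmetricSeed

/-- Membership in a closed thickening bounds the distance to the set: `p ∈ cthickening η B` and `0 ≤ η` give
`infDist p B ≤ η` (if `B = ∅` the left side is `0`). -/
private theorem infDist_le_of_mem_cthickening {p : ℂ} {B : Set ℂ} {η : ℝ} (hη : 0 ≤ η)
    (h : p ∈ Metric.cthickening η B) : Metric.infDist p B ≤ η :=
  ENNReal.toReal_le_of_le_ofReal hη (Metric.mem_cthickening_iff.1 h)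

/-- If a nonempty set `A` lies in the closed `η`-thickening of `B`, then the distance to `B` exceeds the distance
to `A` by at most `η`: `infDist p B ≤ infDist p A + η`. -/
private theorem infDist_le_infDist_add_of_subset_cthickening {p : ℂ} {A B : Set ℂ} {η : ℝ} (hη : 0 ≤ η)
    (hA : A.Nonempty) (h : A ⊆ Metric.cthickening η B) : Metric.infDist p B ≤ Metric.infDist p A + η := by
  have key : Metric.infDist p B - η ≤ Metric.infDist p A := by
    rw [Metric.le_infDist hA]
    intro a ha
    have h1 : Metric.infDist a B ≤ η := infDist_le_of_mem_cthickening hη (h ha)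
    have h2 : Metric.infDist p B ≤ Metric.infDist a B + dist p a := Metric.infDist_le_infDist_add_dist
    linarith
  linarith

/-- SUB-STUB (N2) of `stub_fixedDomainContinuity_one`: **crude event of a close rectangle ⊆ fattened event of
the centre.** -/
theorem stub_crossEvent_subset_upperCrossing_of_close :
    ∀ (R Q : ConformalRectangle) (η ρ δ : ℝ), 0 ≤ δ → 0 ≤ η →
      Q.carrier ⊆ Metric.cthickening η R.carrier →
      Q.arc 0 ⊆ Metric.cthickening η (R.arc 0) → Q.arc 2 ⊆ Metric.cthickening η (R.arc 2) →
      2 * δ + η ≤ ρ →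
      crossEvent Q δ ⊆ Freeze.upperCrossing R ρ δ := by
  intro R Q η ρ δ hδ hη hcar h0 h2 hρ
  rintro ω ⟨x, hx, y, hy, hr⟩
  refine ⟨x, ?_, y, ?_, ?_⟩
  · show Metric.infDist ((δ : ℂ) * squareLatticeEmbedding.z x) (R.arc 0) ≤ ρ
    have hx' : Metric.infDist ((δ : ℂ) * squareLatticeEmbedding.z x) (Q.arc 0) ≤ 2 * δ := hx
    have := infDist_le_infDist_add_of_subset_cthickening (p := (δ : ℂ) * squareLatticeEmbedding.z x) hη
      ⟨Q.pt 0, Q.pt_mem_arc_self 0⟩ h0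
    linarith
  · show Metric.infDist ((δ : ℂ) * squareLatticeEmbedding.z y) (R.arc 2) ≤ ρ
    have hy' : Metric.infDist ((δ : ℂ) * squareLatticeEmbedding.z y) (Q.arc 2) ≤ 2 * δ := hy
    have := infDist_le_infDist_add_of_subset_cthickening (p := (δ : ℂ) * squareLatticeEmbedding.z y) hη
      ⟨Q.pt 2, Q.pt_mem_arc_self 2⟩ h2
    linarith
  · have hsub : {v : Site 2 | (δ : ℂ) * squareLatticeEmbedding.z v ∈ Q.carrier} ⊆
        {v | Metric.infDist ((δ : ℂ) * squareLatticeEmbedding.z v) R.carrier ≤ ρ} := fun v hv => by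
      simp only [Set.mem_setOf_eq] at hv ⊢
      have := infDist_le_of_mem_cthickening hη (hcar hv)
      linarith
    exact Freeze.openConnIn_mono hsub x y hr

end Summit.CriticalPhenomena.CardyFormulaZ2.Cruxes.UniformMarginality.HeatFlow

end
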